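import Literature.NumberTheory.PAdicHodge.BmaxPlusFormalLogPeriodMap
import Literature.NumberTheory.PAdicHodge.AinfThetaFrobeniusKernel
import Literature.NumberTheory.PAdicHodge.BmaxPlusLog
import HarnessLib

/-!
# `θ ∘ φⁿ` on the `A_max`-periods: if the `φ`-partner `φΛ` of a period `Λ = Λ_1(ι y₀)` with `θ(y₀) = 0` lies in `ker θ`, then `([ε] − 1) ∣ y₀`

Topic `Literature/NumberTheory/PAdicHodge`; namespace `Literature.NumberTheory.PAdicHodge`. THEOREMS ONLY (no definition, no named fact, no
instance, no `sorry`). Towards the NON-DEGENERACY of the φ-road's crystalline pair `(Λ, φΛ)` on the Tate module (line `kato_lever`, crux K★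
`stmt-BirchSwinnertonDyer-22226`, memo `Summits/…/Cruxes/StarredOptimalManinUnitFiveSeven/Lines/kato-lever-K2-tower-instantiation.md` §3:
the socket needs `∃ τ, Pη(τ) ∉ Fil¹`, i.e. `θ_max(φ L_τ) ≠ 0` for some `τ ∈ T_pŴ`). This file reduces the vanishing of `θ(φΛ)` to a divisibility in
`𝔸_inf` that the tilt estimates of `AinfWeierstrassHodgeTateNonvanishing` can refute:

* §1 ★ `thetaBmaxZero_eq_zero_of_thetaBmaxPlus_logSum_eq_zero` — **INJECTIVITY of `θ` on the `A_max`-logarithms at index `1`** (`p` odd, `b₁ = 1`):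
  if `y = p·z` in `B⁰_max` and `θ_max(Λ_1(y, z)) = 0` then `θ⁰(y) = 0`. The partial sums satisfy `θ⁰(S_M) ≡ p²·θ⁰(z) (mod p³·θ⁰(z)²)` (the
  coefficients `d_{1,m} = p^{1+m}/m` are divisible by `p³` for `m ≥ 2`, `exists_coeffD_one_eq_pow_three_mul`), and `θ_max(Λ) ≡ θ⁰(S_{2n}) (mod pⁿ)`;
  so `θ⁰(z) ∈ p^k 𝒪` for every `k` by induction, i.e. `θ⁰(z) = 0`.
* §2 `frobBmaxPlus_logSum_algebraMap`, `frobBmaxPlus_pow_logSum_algebraMap` — **`φⁿ(Λ_N(ι y₀, z)) = Λ_N(ι φⁿy₀, φⁿz)`** (naturality,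
  `PadicLogSeries.adicCompletionMap_logSum`; `φ` fixes `ℤ_p`).
* §3 `thetaBmaxPlus_frobBmaxPlus_pow_eq_zero_of_honda` — from the Dieudonné–Honda relation `φ²Λ − A·φΛ + P·Λ = 0` and `θ(Λ) = θ(φΛ) = 0`:
  **`θ(φⁿΛ) = 0` for every `n`** (the `ℤ`-span of `Λ, φΛ` is `φ`-stable).
* §4 ★★ `uAinf_dvd_of_thetaBmaxPlus_frobBmaxPlus_logSum_eq_zero` — for `y₀ ∈ 𝔸_inf` with `θ(y₀) = 0`, `ι(y₀) = p·z`, `Λ = Λ_1(ι y₀, z)` satisfying the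
  Honda relation: **`θ_max(φΛ) = 0 ⟹ ([ε] − 1) ∣ y₀`** (`θ(φⁿΛ) = 0 ∀n` by §3, so `θ(φⁿ y₀) = 0 ∀n` by §1–§2, so Fontaine's `𝔸_inf` lemma
  `uAinf_dvd_iff_forall_fontaineTheta_frobenius_iterate_eq_zero` applies).

Applied to `y₀ = [τ̃]` (a torsion sequence `τ` of a supersingular `Ŵ`, where the tilt of `[τ̃]` is `T̄₁^{p²}·unit` and cannot be divisible by
`ε − 1`), this yields `θ(φ L_τ) ≠ 0` (sequel file). Infrastructure only; BSD / K★ are not proved by any of this.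

## References
* J.-M. Fontaine, *Le corps des périodes p-adiques*, Astérisque 223 (1994), Exp. II §1.5, Exp. III Prop. 5.1.3. [FontaineAsterisque223III]
* P. Colmez, *Périodes p-adiques des variétés abéliennes*, Math. Ann. 292 (1992), §2. [Colmez1992PeriodesAbeliennes]
* T. Honda, *On the theory of commutative formal groups*, J. Math. Soc. Japan 22 (1970), Thm. 2 (p. 223). [Honda1970]
-/

noncomputable section

open WittVector Field ValuativeRel Finset
open Literature.AlgebraicGeometry.Resolution
open Literature.RingTheory.FormalGroups

namespace Literature.NumberTheory.PAdicHodge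

open Literature.NumberTheory.GaloisRepresentations
open Literature.NumberTheory.GaloisRepresentations.IsNonarchimedeanLocalField

variable {F : Type} [Field F] [ValuativeRel F] [TopologicalSpace F] [IsNonarchimedeanLocalField F]
  [CharZero F] {p : ℕ} [Fact p.Prime] [Fact (¬ IsUnit (p : integerC F))]
  [IsAdicComplete (Ideal.span {(p : integerC F)}) (integerC F)]

/-! ## §1 Injectivity of `θ` on the `A_max`-logarithms of index `1` -/

/-- `n ∈ ℤ_p^×` for `p ∤ n`. [folklore] -/
private theorem isUnit_natCast_padicInt {n : ℕ} (h : ¬ p ∣ n) : IsUnit (n : ℤ_[p]) :=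
  PadicInt.isUnit_iff.2 (PadicInt.norm_natCast_eq_one_iff.2 ((Nat.Prime.coprime_iff_not_dvd (Fact.out : p.Prime)).2 h))

/-- `v_p(m) ≤ m − 2` for `m ≥ 2` and `p` odd (`p^{m−2} ≥ 3^{m−2} ≥ m` for `m ≥ 3`; `v_p(2) = 0`). [folklore] -/
private theorem factorization_le_sub_two (hp2 : p ≠ 2) {m : ℕ} (hm : 2 ≤ m) : m.factorization p ≤ m - 2 := by
  have hp := (Fact.out : p.Prime)
  have hp3 : 3 ≤ p := by
    rcases Nat.lt_or_ge p 3 with h | h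
    · interval_cases p <;> simp_all [Nat.not_prime_zero, Nat.not_prime_one]
    · exact h
  rcases Nat.lt_or_ge m 3 with h3 | h3
  · have hm2 : m = 2 := by omega
    subst hm2
    rw [Nat.factorization_eq_zero_of_not_dvd (fun h => hp2 ((Nat.prime_dvd_prime_iff_eq hp Nat.prime_two).1 h))]
  · have h1 : p ^ m.factorization p ≤ m := Nat.ordProj_le p (by omega)
    -- `m < 3^{m-1} ≤ p^{m-1}`, so `v < m - 1`
    have h2 : m < 3 ^ (m - 1) := by
      have key : ∀ k : ℕ, k + 3 < 3 ^ (k + 2) := by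
        intro k
        induction k with
        | zero => norm_num
        | succ k ih => rw [pow_succ]; omega
      have := key (m - 3)
      rwa [show m - 3 + 3 = m by omega, show m - 3 + 2 = m - 1 by omega] at this
    have h3' : 3 ^ (m - 1) ≤ p ^ (m - 1) := Nat.pow_le_pow_left hp3 _
    have h4 : p ^ m.factorization p < p ^ (m - 1) := lt_of_le_of_lt h1 (h2.trans_le h3')
    have h5 := (Nat.pow_lt_pow_iff_right hp.one_lt).1 h4
    omega

/-- **`d_{1,m} = p^{1+m}/m ∈ p³ℤ_p` for `m ≥ 2` and `p` odd** (`v_p(m) ≤ m − 2`). [cite: Colmez1992PeriodesAbeliennes, §2] -/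
theorem exists_coeffD_one_eq_pow_three_mul (hp2 : p ≠ 2) {m : ℕ} (hm : 2 ≤ m) :
    ∃ d' : ℤ_[p], PadicLogSeries.coeffD p 1 m = (p : ℤ_[p]) ^ 3 * d' := by
  have hm0 : m ≠ 0 := by omega
  -- `m · d' = p^{m-2}` is solvable
  have hv := factorization_le_sub_two (p := p) hp2 hm
  obtain ⟨u, hu⟩ := isUnit_natCast_padicInt (p := p) (Nat.not_dvd_ordCompl (Fact.out : p.Prime) hm0)
  have hkm : p ^ m.factorization p * (m / p ^ m.factorization p) = m := Nat.ordProj_mul_ordCompl_eq_self m p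
  set d' : ℤ_[p] := (p : ℤ_[p]) ^ (m - 2 - m.factorization p) * ((u⁻¹ : ℤ_[p]ˣ) : ℤ_[p]) with hd'
  have hmd' : (m : ℤ_[p]) * d' = (p : ℤ_[p]) ^ (m - 2) := by
    calc (m : ℤ_[p]) * d' = ((p ^ m.factorization p * (m / p ^ m.factorization p) : ℕ) : ℤ_[p]) * d' := by rw [hkm]
      _ = (p : ℤ_[p]) ^ m.factorization p * (p : ℤ_[p]) ^ (m - 2 - m.factorization p) * ((u : ℤ_[p]) * ((u⁻¹ : ℤ_[p]ˣ) : ℤ_[p])) := by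
          rw [hu, hd']; push_cast; ring
      _ = (p : ℤ_[p]) ^ (m - 2) := by rw [← pow_add, Nat.add_sub_cancel' hv, Units.mul_inv, mul_one]
  refine ⟨d', mul_left_cancel₀ (Nat.cast_ne_zero.2 hm0 : (m : ℤ_[p]) ≠ 0) ?_⟩
  rw [PadicLogSeries.natCast_mul_coeffD le_rfl hm0, Nat.div_one, mul_left_comm, hmd', ← pow_add]
  congr 1; omega

/-- `d_{1,1} = p²`. [cite: Colmez1992PeriodesAbeliennes, §2] -/
theorem coeffD_one_one : PadicLogSeries.coeffD p 1 1 = (p : ℤ_[p]) ^ 2 := by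
  have h := PadicLogSeries.natCast_mul_coeffD (p := p) (N := 1) (m := 1) le_rfl one_ne_zero
  rwa [Nat.cast_one, one_mul, Nat.div_one] at h

set_option maxHeartbeats 400000 in
/-- **The partial sums modulo `p³·θ⁰(z)²`**: for `y = p·z` in `B⁰_max`, numerators `b` with `b₁ = 1` and `p` odd,
`θ⁰(S_{M+1}) − p²·θ⁰(z) ∈ (p³·θ⁰(z)²)` (`S_{M+1} = T_1 + Σ_{m ≥ 2} T_m`, `T_1 = ι(p²)·z`, `T_m = ι(b_m d_{1,m})·z^m` with `p³ ∣ d_{1,m}`).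
[cite: Colmez1992PeriodesAbeliennes, §2] -/
theorem thetaBmaxZero_partialSum_sub_mem (hp2 : p ≠ 2) (ι : ℤ_[p] →+* bmaxZero F p) (b : ℕ → ℤ_[p]) (hb1 : b 1 = 1) (y z : bmaxZero F p)
    (M : ℕ) :
    thetaBmaxZero F p (PadicLogSeries.partialSum ι b 1 y z (M + 1)) - (p : integerC F) ^ 2 * thetaBmaxZero F p z ∈
      Ideal.span {(p : integerC F) ^ 3 * thetaBmaxZero F p z ^ 2} := by
  induction M with
  | zero =>
    have hT : thetaBmaxZero F p (PadicLogSeries.term ι b 1 y z (0 + 1)) = (p : integerC F) ^ 2 * thetaBmaxZero F p z := by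
      rw [zero_add, PadicLogSeries.term, hb1, one_mul, coeffD_one_one]
      simp only [Nat.div_one, Nat.mod_one, pow_one, pow_zero, mul_one, map_mul, map_pow, map_natCast]
    rw [PadicLogSeries.partialSum_succ, PadicLogSeries.partialSum_zero, zero_add, hT, sub_self]
    exact Submodule.zero_mem _
  | succ M ih =>
    obtain ⟨d', hd'⟩ := exists_coeffD_one_eq_pow_three_mul (p := p) hp2 (m := M + 1 + 1) (by omega)
    have hT : thetaBmaxZero F p (PadicLogSeries.term ι b 1 y z (M + 1 + 1)) =
        (thetaBmaxZero F p (ι (b (M + 1 + 1))) * thetaBmaxZero F p (ι d') * thetaBmaxZero F p z ^ M) *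
          ((p : integerC F) ^ 3 * thetaBmaxZero F p z ^ 2) := by
      rw [PadicLogSeries.term, hd']
      simp only [Nat.div_one, Nat.mod_one, pow_zero, mul_one, map_mul, map_pow, map_natCast]
      ring
    rw [PadicLogSeries.partialSum_succ, map_add, add_sub_right_comm, hT]
    exact Ideal.add_mem _ ih (Ideal.mem_span_singleton'.2 ⟨_, rfl⟩)

set_option maxHeartbeats 1600000 in
/-- ★ **Injectivity of `θ` on the `A_max`-logarithms of index `1`.** Let `p` be odd, `b` numerators with `b₁ = 1` (e.g. `formalLogNum W p`),
`y, z ∈ B⁰_max` with `y = p·z` (witness at index `N = 1`), and `Λ = Λ_1(y, z) ∈ A_max` (`PadicLogSeries.logSum`). If `θ_max(Λ) = 0` then `θ⁰(y) = 0`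
(indeed `θ⁰(z) = 0`): `θ_max(Λ) ≡ θ⁰(S_{2n}) (mod pⁿ)` and `θ⁰(S_{2n}) ≡ p²θ⁰(z) (mod p³θ⁰(z)²)`, so `θ⁰(z) ∈ p^k𝒪_{ℂ_F} ⇒ θ⁰(z) ∈ p^{k+1}𝒪_{ℂ_F}`,
and `𝒪_{ℂ_F}` is `p`-adically separated. (Classically: `|log_W(c)| = |c|` for `|c| ≤ |p|`, `p` odd.) [cite: Colmez1992PeriodesAbeliennes, §2]
[cite: FontaineAsterisque223III, Exp. II §1.5] -/
theorem thetaBmaxZero_eq_zero_of_thetaBmaxPlus_logSum_eq_zero (hp2 : p ≠ 2) (ι : ℤ_[p] →+* bmaxZero F p) (b : ℕ → ℤ_[p]) (hb1 : b 1 = 1)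
    {y z : bmaxZero F p} (hyz : y ^ 1 = (p : bmaxZero F p) * z)
    (h0 : thetaBmaxPlus F p (PadicLogSeries.logSum ι b 1 y z) = 0) : thetaBmaxZero F p y = 0 := by
  have hp0 : (p : integerC F) ≠ 0 := natCast_integerC_ne_zero (Fact.out : p.Prime).ne_zero
  set c := thetaBmaxZero F p z with hc
  -- `θ_max(Λ) ≡ θ⁰(S_{2n}) (mod pⁿ)`, hence `θ⁰(S_{2n}) ∈ pⁿ𝒪`
  have hlev : ∀ n, thetaBmaxZero F p (PadicLogSeries.partialSum ι b 1 y z (2 * n * 1)) ∈ Ideal.span {(p : integerC F)} ^ n := fun n => by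
    have h := thetaBmaxPlus_sub_mem_of_evalₐ_eq (PadicLogSeries.evalₐ_logSum ι b y z le_rfl n)
    rwa [h0, zero_sub, neg_mem_iff] at h
  -- induction: `c ∈ p^k 𝒪` for all `k`
  have hind : ∀ k : ℕ, c ∈ Ideal.span {(p : integerC F)} ^ k := by
    intro k
    induction k with
    | zero => rw [pow_zero, Ideal.one_eq_top]; exact Submodule.mem_top
    | succ k ih =>
      rw [Ideal.span_singleton_pow, Ideal.mem_span_singleton'] at ih ⊢
      obtain ⟨c', hc'⟩ := ih
      -- read `θ⁰(S_{2n})` with `2n = (k + 3) + … ≥ 1`: take `n = k + 3`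
      have hS := hlev (k + 3)
      have hmem := thetaBmaxZero_partialSum_sub_mem hp2 ι b hb1 y z (2 * (k + 3) * 1 - 1)
      rw [show 2 * (k + 3) * 1 - 1 + 1 = 2 * (k + 3) * 1 by omega] at hmem
      rw [Ideal.span_singleton_pow, Ideal.mem_span_singleton'] at hS
      obtain ⟨s, hs⟩ := hS
      obtain ⟨w, hw⟩ := Ideal.mem_span_singleton'.1 hmem
      -- `p²c = s p^{k+3} − w p³ c²`, `c = c' p^k`: cancel `p^{k+2}`
      have e1 : (p : integerC F) ^ 2 * c = s * (p : integerC F) ^ (k + 3) - w * ((p : integerC F) ^ 3 * c ^ 2) := by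
        linear_combination hw - hs
      rw [← hc'] at e1
      have e2 : (p : integerC F) ^ (k + 2) * c' = (p : integerC F) ^ (k + 2) * ((s - w * c' ^ 2 * (p : integerC F) ^ k) * p) := by
        linear_combination e1
      have e3 := mul_left_cancel₀ (pow_ne_zero _ hp0) e2
      refine ⟨s - w * c' ^ 2 * (p : integerC F) ^ k, ?_⟩
      rw [← hc', pow_succ]
      linear_combination -((p : integerC F) ^ k) * e3
  have hc0 : c = 0 := eq_zero_of_forall_mem_span_pow hind
  have hy : y = (p : bmaxZero F p) * z := by rw [← hyz, pow_one]
  rw [hy, map_mul, ← hc, hc0, mul_zero]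

/-! ## §2 `φⁿ(Λ_N(ι y₀, z)) = Λ_N(ι φⁿ y₀, φⁿ z)` -/

omit [CharZero F] [IsAdicComplete (Ideal.span {(p : integerC F)}) (integerC F)] in
set_option maxHeartbeats 1600000 in
/-- **`φ(Λ_N(ι y₀, z)) = Λ_N(ι(φ y₀), φ z)`**: the Frobenius of `A_max` acts on the `p`-adic log-sums through its arguments (naturality
`PadicLogSeries.adicCompletionMap_logSum`; `φ` fixes `ℤ_p`). [cite: Colmez1992PeriodesAbeliennes, §2] -/
theorem frobBmaxPlus_logSum_algebraMap (b : ℕ → ℤ_[p]) (N : ℕ) (y₀ : Ainf (p := p) F) (z : bmaxZero F p) :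
    frobBmaxPlus F p (PadicLogSeries.logSum ((algebraMap (Ainf (p := p) F) (bmaxZero F p)).comp zpToAinf) b N
        (algebraMap (Ainf (p := p) F) (bmaxZero F p) y₀) z) =
      PadicLogSeries.logSum ((algebraMap (Ainf (p := p) F) (bmaxZero F p)).comp zpToAinf) b N
        (algebraMap (Ainf (p := p) F) (bmaxZero F p) (WittVector.frobenius y₀)) (frobBmaxZero F p z) := by
  have h := PadicLogSeries.adicCompletionMap_logSum ((algebraMap (Ainf (p := p) F) (bmaxZero F p)).comp zpToAinf) b N
    (algebraMap (Ainf (p := p) F) (bmaxZero F p) y₀) z (frobBmaxZero F p)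
  rw [frobBmaxZero_comp_algebraMap_comp_zpToAinf, frobBmaxZero_algebraMap] at h
  exact h

omit [CharZero F] [IsAdicComplete (Ideal.span {(p : integerC F)}) (integerC F)] in
set_option maxHeartbeats 1600000 in
/-- **`φⁿ(Λ_N(ι y₀, z)) = Λ_N(ι(φⁿ y₀), φⁿ z)`.** [cite: Colmez1992PeriodesAbeliennes, §2] -/
theorem frobBmaxPlus_pow_logSum_algebraMap (b : ℕ → ℤ_[p]) (N : ℕ) (y₀ : Ainf (p := p) F) (z : bmaxZero F p) (n : ℕ) :
    (frobBmaxPlus F p ^ n) (PadicLogSeries.logSum ((algebraMap (Ainf (p := p) F) (bmaxZero F p)).comp zpToAinf) b N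
        (algebraMap (Ainf (p := p) F) (bmaxZero F p) y₀) z) =
      PadicLogSeries.logSum ((algebraMap (Ainf (p := p) F) (bmaxZero F p)).comp zpToAinf) b N
        (algebraMap (Ainf (p := p) F) (bmaxZero F p) (((WittVector.frobenius : Ainf (p := p) F →+* Ainf (p := p) F) ^ n) y₀)) ((frobBmaxZero F p ^ n) z) := by
  induction n generalizing y₀ z with
  | zero => simp only [pow_zero, RingHom.one_def, RingHom.id_apply]
  | succ n ih =>
    simp only [pow_succ, RingHom.mul_def, RingHom.comp_apply]
    rw [frobBmaxPlus_logSum_algebraMap, ih]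

omit [CharZero F] [IsAdicComplete (Ideal.span {(p : integerC F)}) (integerC F)] in
/-- The witness is transported by `φⁿ`: `(ι φⁿ y₀)^N = p·φⁿ z`. [cite: Colmez1992PeriodesAbeliennes, §2] -/
theorem algebraMap_frobenius_pow_pow_eq (N : ℕ) {y₀ : Ainf (p := p) F} {z : bmaxZero F p}
    (hz : algebraMap (Ainf (p := p) F) (bmaxZero F p) y₀ ^ N = (p : bmaxZero F p) * z) (n : ℕ) :
    algebraMap (Ainf (p := p) F) (bmaxZero F p) (((WittVector.frobenius : Ainf (p := p) F →+* Ainf (p := p) F) ^ n) y₀) ^ N = (p : bmaxZero F p) * (frobBmaxZero F p ^ n) z := by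
  induction n generalizing y₀ z with
  | zero => simpa only [pow_zero, RingHom.one_def, RingHom.id_apply] using hz
  | succ n ih =>
    have h := ih hz
    have h2 := congrArg (frobBmaxZero F p) h
    rw [map_pow, frobBmaxZero_algebraMap, map_mul, map_natCast] at h2
    rw [pow_succ', pow_succ', RingHom.mul_def, RingHom.comp_apply, RingHom.mul_def, RingHom.comp_apply]
    exact h2

/-! ## §3 The Honda relation propagates `θ = 0` along `φⁿ` -/

/-- Pure algebra: for ring maps `f : R → R`, `θ : R → S` and `f(fΛ) − A·fΛ + P·Λ = 0` with `θ(Λ) = θ(fΛ) = 0`, all `θ(fⁿΛ)` and `θ(fⁿ(fΛ))`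
vanish (the `ℤ[A, P]`-span of `Λ, fΛ` is `f`-stable and killed by `θ`). [folklore] -/
private theorem map_pow_apply_eq_zero_of_honda {R S : Type*} [CommRing R] [CommRing S] (f : R →+* R) (θ : R →+* S) {A P Λ : R}
    (hrel : f (f Λ) - A * f Λ + P * Λ = 0) (h₀ : θ Λ = 0) (h₁ : θ (f Λ) = 0) (n : ℕ) :
    θ ((f ^ n) Λ) = 0 ∧ θ ((f ^ n) (f Λ)) = 0 := by
  induction n with
  | zero => exact ⟨by simpa using h₀, by simpa using h₁⟩
  | succ n ih =>
    have e : f (f Λ) = A * f Λ - P * Λ := by linear_combination hrel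
    have hstep : f ^ (n + 1) = (f ^ n).comp f := by rw [pow_succ, RingHom.mul_def]
    refine ⟨?_, ?_⟩
    · rw [hstep, RingHom.comp_apply]; exact ih.2
    · rw [hstep, RingHom.comp_apply, e, map_sub, map_mul, map_mul, map_sub, map_mul, map_mul, ih.1, ih.2, mul_zero, mul_zero, sub_zero]

/-- **If `φ²Λ − A·φΛ + P·Λ = 0` and `θ(Λ) = θ(φΛ) = 0` then `θ(φⁿΛ) = 0` and `θ(φⁿ(φΛ)) = 0` for every `n`** (`θ` kills the `φ`-stable `ℤ[A, P]`-span
of `Λ, φΛ`). [cite: Honda1970, Thm. 2 (p. 223)] -/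
theorem thetaBmaxPlus_frobBmaxPlus_pow_eq_zero_of_honda {A P Λ : BmaxPlus F p}
    (hrel : frobBmaxPlus F p (frobBmaxPlus F p Λ) - A * frobBmaxPlus F p Λ + P * Λ = 0)
    (h₀ : thetaBmaxPlus F p Λ = 0) (h₁ : thetaBmaxPlus F p (frobBmaxPlus F p Λ) = 0) (n : ℕ) :
    thetaBmaxPlus F p ((frobBmaxPlus F p ^ n) Λ) = 0 ∧ thetaBmaxPlus F p ((frobBmaxPlus F p ^ n) (frobBmaxPlus F p Λ)) = 0 :=
  map_pow_apply_eq_zero_of_honda (frobBmaxPlus F p) (thetaBmaxPlus F p) hrel h₀ h₁ n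

/-! ## §4 `θ(φΛ) = 0 ⟹ ([ε] − 1) ∣ y₀` -/

set_option maxHeartbeats 1600000 in
/-- ★★ **If the `φ`-partner of the period lies in `ker θ`, the argument is divisible by `[ε] − 1`.** Let `p` be odd, `b` numerators with `b₁ = 1`,
`y₀ ∈ 𝔸_inf` with `θ(y₀) = 0` and `ι(y₀) = p·z` in `B⁰_max`, and `Λ = Λ_1(ι y₀, z) ∈ A_max` satisfying a Dieudonné–Honda relation
`φ²Λ − A·φΛ + P·Λ = 0` (e.g. the period of a torsion sequence, `BmaxPlusFormalLogDivisionTower`). If `θ_max(φΛ) = 0` then **`([ε] − 1) ∣ y₀` in `𝔸_inf`**: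
`θ(φⁿΛ) = 0` for all `n` (§3), `φⁿΛ = Λ_1(ι φⁿy₀, φⁿz)` (§2), so `θ(φⁿ y₀) = 0` for all `n` (§1), and Fontaine's `𝔸_inf` lemma
(`uAinf_dvd_iff_forall_fontaineTheta_frobenius_iterate_eq_zero`) concludes. [cite: FontaineAsterisque223III, Exp. III Prop. 5.1.3]
[cite: Colmez1992PeriodesAbeliennes, §2] -/
theorem uAinf_dvd_of_thetaBmaxPlus_frobBmaxPlus_logSum_eq_zero (hp2 : p ≠ 2) (b : ℕ → ℤ_[p]) (hb1 : b 1 = 1) {y₀ : Ainf (p := p) F}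
    (hy₀ : fontaineTheta (integerC F) p y₀ = 0) {z : bmaxZero F p}
    (hz : algebraMap (Ainf (p := p) F) (bmaxZero F p) y₀ ^ 1 = (p : bmaxZero F p) * z) {A P : BmaxPlus F p}
    (hrel : frobBmaxPlus F p (frobBmaxPlus F p
        (PadicLogSeries.logSum ((algebraMap (Ainf (p := p) F) (bmaxZero F p)).comp zpToAinf) b 1
          (algebraMap (Ainf (p := p) F) (bmaxZero F p) y₀) z)) -
      A * frobBmaxPlus F p (PadicLogSeries.logSum ((algebraMap (Ainf (p := p) F) (bmaxZero F p)).comp zpToAinf) b 1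
          (algebraMap (Ainf (p := p) F) (bmaxZero F p) y₀) z) +
      P * PadicLogSeries.logSum ((algebraMap (Ainf (p := p) F) (bmaxZero F p)).comp zpToAinf) b 1
          (algebraMap (Ainf (p := p) F) (bmaxZero F p) y₀) z = 0)
    (hθ : thetaBmaxPlus F p (frobBmaxPlus F p
        (PadicLogSeries.logSum ((algebraMap (Ainf (p := p) F) (bmaxZero F p)).comp zpToAinf) b 1
          (algebraMap (Ainf (p := p) F) (bmaxZero F p) y₀) z)) = 0) :
    (uAinf : Ainf (p := p) F) ∣ y₀ := by
  have h₀ : thetaBmaxPlus F p (PadicLogSeries.logSum ((algebraMap (Ainf (p := p) F) (bmaxZero F p)).comp zpToAinf) b 1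
      (algebraMap (Ainf (p := p) F) (bmaxZero F p) y₀) z) = 0 :=
    AinfTop.thetaBmaxPlus_logSum_eq_zero _ b le_rfl hz (by rw [thetaBmaxZero_algebraMap, hy₀])
  refine (uAinf_dvd_iff_forall_fontaineTheta_frobenius_iterate_eq_zero y₀).2 fun n => ?_
  have hn := (thetaBmaxPlus_frobBmaxPlus_pow_eq_zero_of_honda hrel h₀ hθ n).1
  rw [frobBmaxPlus_pow_logSum_algebraMap] at hn
  have h := thetaBmaxZero_eq_zero_of_thetaBmaxPlus_logSum_eq_zero hp2 _ b hb1 (algebraMap_frobenius_pow_pow_eq 1 hz n) hn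
  rw [thetaBmaxZero_algebraMap] at h
  rw [← RingHom.coe_pow]
  exact h

end Literature.NumberTheory.PAdicHodge

end
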